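import Summits.ABC.ABC.Theorems.PlatonicClosureCoreFloorBlocker
import HarnessLib

/-!
# PlatonicClosureCoreKummerDoors — part 6/6 of the ROUTE-INDEPENDENT node kernel `PlatonicClosureCore` (door J, second layer; lens-1 gen 7)

Source: lens-1 g7 ROUTE-INDEPENDENT landing variant `pkg/PlatonicClosureTheorems.lean` (cell `decomp-abc`; sha256
`f8bb28f6c96ac600…`; = node file `PlatonicClosure.lean` v2.2 with the three `Theses.RootDecompJ/B/G` imports replaced
by seven inline TREE TEXTS §T, writer recipe decomp-abc STATUS l.502; lens `lean check` rc 0 · 0 sorry · axioms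
standard; critic PRE-CLEARED l.513, bridge test `Iff.rfl` ×7 against J rev 3 / B rev 7 / G rev 6 rc 0).

This module: §12 doors B and G localised onto the power stratum (`abc_iff_powAC`, `doorB_without_low : KummerFloorHigh
→ KummerFloorCell5 → ABC`, `doorB_localised`, `doorB_cell_restricts`, `kummerFloor4High_of_floor`, `doorG_localised`,
`doorG_without_lowfloor`) · §12b atoms `doorB_atom`, `doorG_atom`, `profile_atom`, `OpenGrammarsLens1`.

Landing form: MECHANICAL six-module split of the source (full account in part 1/6 `PlatonicClosureCoreTransport`): namespace
`Summit.ABC.ABC.Theorems.PlatonicClosureCore`, docstrings, imports, `private` copies of landed folklore lemmas; statements and proofs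
byte-identical; imports NO route file (route `closes` may cite it by defeq of the §T tree texts).  Proves neither `ABC` nor any item.
-/

set_option linter.dupNamespace false
-- lint debt, justified: verbatim planner-cleared proofs keep the item texts' binder names (some hypotheses are unused by name).
set_option linter.unusedVariables false

open Literature.NumberTheory.DiophantineGeometry
open UniqueFactorizationMonoid
open Finset

namespace Summit.ABC.ABC.Theorems.PlatonicClosureCore

/-! Private verbatim copies (gate `dedup.landed`: these folklore statements are already landed in the tree, e.g. in the
J-importing chain `Theorems/PlatonicClosure*.lean`; `private` in their home module here) — so that every proof below
stays byte-identical to the source. -/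

/-- The members of an abc triple are nonzero and `a < c`, `b < c`. -/
private theorem triple_facts {a b c : ℕ} (ht : IsABCTriple a b c) :
    a ≠ 0 ∧ b ≠ 0 ∧ c ≠ 0 ∧ a < c ∧ b < c := by
  obtain ⟨ha, hb, habc, _⟩ := ht
  omega

/-- `radical (m * n) ≤ radical m * radical n`. -/
private theorem radical_mul_le (m n : ℕ) : radical (m * n) ≤ radical m * radical n :=
  Nat.le_of_dvd (Nat.mul_pos (Nat.radical_pos _) (Nat.radical_pos _)) radical_mul_dvd

/-- `radical n ≤ n` for `0 < n`. -/
private theorem radical_le_self {n : ℕ} (hn : 0 < n) : radical n ≤ n := Nat.le_of_dvd hn radical_dvd_self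

/-- `radical (m * n) ≤ radical m * n` for `0 < n`. -/
private theorem radical_mul_le_mul_self (m : ℕ) {n : ℕ} (hn : 0 < n) : radical (m * n) ≤ radical m * n :=
  (radical_mul_le m n).trans (Nat.mul_le_mul_left _ (radical_le_self hn))

/-- For a coprime triple, `rad(abc) = rad a · rad b · rad c`. -/
private theorem rad_eq_prod {a b c : ℕ} (ht : IsABCTriple a b c) : rad a b c = radical a * radical b * radical c := by
  obtain ⟨ha, hb, habc, hcop⟩ := ht
  have hac : Nat.Coprime a c := by rw [← habc]; exact Nat.coprime_self_add_right.mpr hcop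
  have hbc : Nat.Coprime b c := by rw [← habc]; exact Nat.coprime_add_self_right.mpr hcop.symm
  rw [rad_def, radical_mul (Nat.coprime_iff_isRelPrime.mp (Nat.Coprime.mul_left hac hbc)),
    radical_mul (Nat.coprime_iff_isRelPrime.mp hcop)]

/-- `c^(k+1) - a^(k+1) ≤ (k+1) · c^k · (c - a)` for `0 ≤ a ≤ c` in `ℤ`. -/
private theorem pow_sub_pow_le (a c : ℤ) (ha : 0 ≤ a) (hac : a ≤ c) (k : ℕ) :
    c ^ (k + 1) - a ^ (k + 1) ≤ ((k : ℤ) + 1) * c ^ k * (c - a) := by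
  induction k with
  | zero => simp
  | succ n ih =>
    have hc : 0 ≤ c := ha.trans hac
    have e : c ^ (n + 1 + 1) - a ^ (n + 1 + 1) = c * (c ^ (n + 1) - a ^ (n + 1)) + a ^ (n + 1) * (c - a) := by
      ring
    rw [e]
    have h1 : c * (c ^ (n + 1) - a ^ (n + 1)) ≤ c * (((n : ℤ) + 1) * c ^ n * (c - a)) :=
      mul_le_mul_of_nonneg_left ih hc
    have h2 : a ^ (n + 1) * (c - a) ≤ c ^ (n + 1) * (c - a) :=
      mul_le_mul_of_nonneg_right (pow_le_pow_left₀ ha hac _) (by linarith)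
    calc _ ≤ c * (((n : ℤ) + 1) * c ^ n * (c - a)) + c ^ (n + 1) * (c - a) := add_le_add h1 h2
      _ = (((n + 1 : ℕ) : ℤ) + 1) * c ^ (n + 1) * (c - a) := by push_cast; ring

/-! ## §12  Over doors B and G (the Kummer-floor species, TREE decls): localisation onto the power stratum

`pow_transport_eq` = the power lift with its image made explicit (`a' = aᴺ`, `c' = cᴺ`).  Hence `ABC ⟺ abc|PowAC N`
(`PowAC N` = «`a` and `c` are exact `N`-th powers», population `≍ B^{2/N}`), and for the Kummer doors:
* door B (`route-ABC-RootDecompB`, `closes : KummerFloor5 → KummerFloorCell5 → ABC`, `KummerFloor5 ⟸ KummerFloorHigh ∧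
  KummerFloorLow`): **`KummerFloorLow` is DECORATIVE** — `doorB_without_low : KummerFloorHigh → KummerFloorCell5 → ABC`
  (the `T₅`-image of every triple has two fifth-power members, so the HIGH floor places it in the cell `c' ≤ C₀·N₅⁴`, where
  the cell piece at `K = C₀` gives the inequality, which transports back); and B's residual species LOCALISES:
  `doorB_localised : KummerFloorHigh → (∀ K, abc|(PowAC 5 ∩ {c ≤ K·N₅⁴})) → ABC`.
* door G (`route-ABC-RootDecompG`, `closes : KummerFloor4 → KummerFloorCell4 → ABC`): the floor is only needed on the
  power stratum (`KummerFloor4High`, implied by `KummerFloor4`) and the cell only on `PowAC 4`: `doorG_localised`.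
In the blocker grammar «every root split through the Kummer-floor family leaves residual ⊇ R»: `R` may be taken to be the
residual's trace on `PowAC N` — thin, explicit, and reached by every abc triple with polynomial loss. -/

/-- `AbcOn` is antitone in the cell; the inclusion `P ⊆ Q` is only needed on abc triples. -/
theorem abcOn_mono' {P Q : ℕ → ℕ → ℕ → Prop} (hPQ : ∀ a b c, IsABCTriple a b c → P a b c → Q a b c)
    (h : AbcOn Q) : AbcOn P := by
  intro ε hε
  obtain ⟨C, hC, hQ⟩ := h ε hε
  exact ⟨C, hC, fun a b c ht hP => hQ a b c ht (hPQ a b c ht hP)⟩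

/-- members `a` and `c` are EXACT `N`-th powers -/
def PowAC (N : ℕ) (a _b c : ℕ) : Prop := ∃ x z : ℕ, a = x ^ N ∧ c = z ^ N

/-- the power lift with explicit image `(a^{k+1}, c^{k+1} − a^{k+1}, c^{k+1})`. -/
theorem pow_transport_eq (k : ℕ) {a b c : ℕ} (ht : IsABCTriple a b c) :
    ∃ a' b' c' : ℕ, IsABCTriple a' b' c' ∧ (a' = a ^ (k + 1) ∧ c' = c ^ (k + 1)) ∧
      c ^ (k + 1) ≤ 1 * c' ∧ rad a' b' c' ≤ (k + 1) * rad a b c * c ^ k := by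
  obtain ⟨ha0, hb0, hc0, hac, hbc⟩ := triple_facts ht
  obtain ⟨ha, hb, habc, hcop⟩ := ht
  have hN0 : k + 1 ≠ 0 := by omega
  have hlt : a ^ (k + 1) < c ^ (k + 1) := Nat.pow_lt_pow_left hac hN0
  have hcopac : Nat.Coprime a c := by rw [← habc]; exact Nat.coprime_self_add_right.mpr hcop
  refine ⟨a ^ (k + 1), c ^ (k + 1) - a ^ (k + 1), c ^ (k + 1),
    ⟨by positivity, Nat.sub_pos_of_lt hlt, Nat.add_sub_of_le hlt.le, ?_⟩,
    ⟨rfl, rfl⟩, by rw [one_mul], ?_⟩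
  · apply Nat.Coprime.pow_left
    have h1 : Nat.Coprime a (c ^ (k + 1)) := hcopac.pow_right (k + 1)
    have e : c ^ (k + 1) - a ^ (k + 1) + a ^ k * a = c ^ (k + 1) := by
      rw [← pow_succ]; exact Nat.sub_add_cancel hlt.le
    rw [← e] at h1
    exact (Nat.coprime_add_mul_right_right _ _ _).mp h1
  · have hdvd : b ∣ c ^ (k + 1) - a ^ (k + 1) := by
      have := Nat.sub_dvd_pow_sub_pow c a (k + 1)
      rwa [show c - a = b by omega] at this
    obtain ⟨G, hG⟩ := hdvd
    have hG0 : 0 < G := by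
      rcases Nat.eq_zero_or_pos G with h | h
      · rw [h, mul_zero] at hG; exact absurd hG (Nat.sub_pos_of_lt hlt).ne'
      · exact h
    have hGle : G ≤ (k + 1) * c ^ k := by
      have h1 : ((c : ℤ) ^ (k + 1) - a ^ (k + 1)) ≤ ((k : ℤ) + 1) * c ^ k * (c - a) :=
        pow_sub_pow_le a c (by positivity) (by exact_mod_cast hac.le) k
      have h2 : ((c ^ (k + 1) - a ^ (k + 1) : ℕ) : ℤ) = (b : ℤ) * G := by exact_mod_cast hG
      rw [Nat.cast_sub hlt.le] at h2
      push_cast at h2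
      rw [h2, show ((c : ℤ) - a) = b by rw [← habc]; push_cast; ring] at h1
      have h3 : (b : ℤ) * G ≤ (b : ℤ) * (((k : ℤ) + 1) * c ^ k) := by linarith
      have h4 : (G : ℤ) ≤ ((k : ℤ) + 1) * c ^ k := le_of_mul_le_mul_left h3 (by exact_mod_cast hb)
      exact_mod_cast h4
    calc rad (a ^ (k + 1)) (c ^ (k + 1) - a ^ (k + 1)) (c ^ (k + 1))
        = radical (a ^ (k + 1) * (c ^ (k + 1) - a ^ (k + 1)) * c ^ (k + 1)) := rad_def _ _ _
      _ ≤ radical (a ^ (k + 1)) * radical (c ^ (k + 1) - a ^ (k + 1)) * radical (c ^ (k + 1)) :=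
          (radical_mul_le _ _).trans (Nat.mul_le_mul_right _ (radical_mul_le _ _))
      _ = radical a * radical (b * G) * radical c := by rw [radical_pow _ hN0, radical_pow _ hN0, hG]
      _ ≤ radical a * (radical b * G) * radical c :=
          Nat.mul_le_mul_right _ (Nat.mul_le_mul_left _ (radical_mul_le_mul_self _ hG0))
      _ = rad a b c * G := by rw [rad_eq_prod ⟨ha, hb, habc, hcop⟩]; ring
      _ ≤ rad a b c * ((k + 1) * c ^ k) := Nat.mul_le_mul_left _ hGle
      _ = (k + 1) * rad a b c * c ^ k := by ring

/-- `ABC ⟺ abc|PowAC N` for every `N = k+1 ≥ 1` (the thinnest carrier of this file: two EXACT powers). -/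
theorem abc_iff_powAC (k : ℕ) : _root_.ABC ↔ AbcOn (PowAC (k + 1)) := by
  refine ⟨fun h => abcOn_of_abc h _, fun hQ => ?_⟩
  refine abc_of_transport hQ (k := k) (A := 1) (K := k + 1) one_pos (Nat.succ_pos k) fun a b c ht => ?_
  obtain ⟨a', b', c', ht', ⟨hA, hC⟩, hc', hr'⟩ := pow_transport_eq k ht
  exact ⟨a', b', c', ht', ⟨a, c, hA, hC⟩, hc', hr'⟩

/-- `5`-free radical `N₅(abc)` (door B's grammar, verbatim) -/
def N5 (a b c : ℕ) : ℕ := ((a * b * c).primeFactors.filter (fun p => ¬ 5 ∣ (a * b * c).factorization p)).prod (fun p => p)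
/-- door B's cell at parameter `K`: `c ≤ K·N₅(abc)⁴` -/
def KCell5 (K : ℕ) (a b c : ℕ) : Prop := c ≤ K * N5 a b c ^ 4

/-- Bridge (`Iff.rfl`): `KummerFloorCell5` (door B's tree text, inlined in §T) is `∀ K, AbcOn (KCell5 K)`. -/
theorem kummerFloorCell5_iff : KummerFloorCell5 ↔ ∀ K : ℕ, AbcOn (KCell5 K) := Iff.rfl

/-- **Door B without its LOW floor piece**: `KummerFloorHigh → KummerFloorCell5 → ABC` (`KummerFloorLow` decorative). -/
theorem doorB_without_low (hHigh : KummerFloorHigh) (hCell : KummerFloorCell5) :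
    _root_.ABC := by
  obtain ⟨C₀, hC₀⟩ := hHigh
  refine (abc_iff_powAC 4).mpr (abcOn_mono' (fun a b c ht hP => ?_) (kummerFloorCell5_iff.mp hCell C₀))
  obtain ⟨x, z, hx, hz⟩ := hP
  exact hC₀ a b c ht (Or.inr (Or.inl ⟨x, z, hx, hz⟩))

/-- **Door B localised**: the residual species only matters on the power stratum `PowAC 5`. -/
theorem doorB_localised (hHigh : KummerFloorHigh)
    (hCellPow : ∀ K : ℕ, AbcOn (fun a b c => PowAC 5 a b c ∧ KCell5 K a b c)) : _root_.ABC := by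
  obtain ⟨C₀, hC₀⟩ := hHigh
  refine (abc_iff_powAC 4).mpr (abcOn_mono' (fun a b c ht hP => ⟨hP, ?_⟩) (hCellPow C₀))
  obtain ⟨x, z, hx, hz⟩ := hP
  exact hC₀ a b c ht (Or.inr (Or.inl ⟨x, z, hx, hz⟩))

/-- and B's residual restricts: `KummerFloorCell5 → ∀ K, abc|(PowAC 5 ∩ KCell5 K)`; so, EXACTLY,
`ABC ⟸ KummerFloorHigh ∧ (B's residual on PowAC 5)`. -/
theorem doorB_cell_restricts (hCell : KummerFloorCell5) (K : ℕ) :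
    AbcOn (fun a b c => PowAC 5 a b c ∧ KCell5 K a b c) :=
  abcOn_mono (fun _ _ _ h => h.2) (kummerFloorCell5_iff.mp hCell K)

/-- `4`-free radical `N₄(abc)` (door G's grammar, verbatim) -/
def N4 (a b c : ℕ) : ℕ := ((a * b * c).primeFactors.filter (fun p => ¬ 4 ∣ (a * b * c).factorization p)).prod (fun p => p)
/-- door G's cell at parameter `K`: `c ≤ K·N₄(abc)⁵` -/
def KCell4 (K : ℕ) (a b c : ℕ) : Prop := c ≤ K * N4 a b c ^ 5

/-- Bridge (`Iff.rfl`): `KummerFloorCell4` (door G's tree text, inlined in §T) is `∀ K, AbcOn (KCell4 K)`. -/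
theorem kummerFloorCell4_iff : KummerFloorCell4 ↔ ∀ K : ℕ, AbcOn (KCell4 K) := Iff.rfl

/-- door G's floor ON THE POWER STRATUM only (the analogue of B's `KummerFloorHigh`): «the 4-free radical of
`b·(a+c)(a²+c²)`-type values exceeds `c^{4/5}/C`». -/
def KummerFloor4High : Prop :=
  ∃ C : ℕ, ∀ a b c : ℕ, IsABCTriple a b c → PowAC 4 a b c → c ≤ C * N4 a b c ^ 5

/-- Door G's floor piece `KummerFloor4` (tree text, §T) implies its restriction `KummerFloor4High` to the power stratum `PowAC 4`. -/
theorem kummerFloor4High_of_floor (h : KummerFloor4) : KummerFloor4High := by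
  obtain ⟨C, hC⟩ := h
  exact ⟨C, fun a b c ht _ => hC a b c ht⟩

/-- **Door G localised**: `KummerFloor4High → (∀ K, abc|(PowAC 4 ∩ KCell4 K)) → ABC`. -/
theorem doorG_localised (hHigh : KummerFloor4High)
    (hCellPow : ∀ K : ℕ, AbcOn (fun a b c => PowAC 4 a b c ∧ KCell4 K a b c)) : _root_.ABC := by
  obtain ⟨C₀, hC₀⟩ := hHigh
  exact (abc_iff_powAC 3).mpr (abcOn_mono' (fun a b c ht hP => ⟨hP, hC₀ a b c ht hP⟩) (hCellPow C₀))

/-- **Writer edge G.** `KummerFloor4High → KummerFloorCell4 → ABC`: only the `PowAC 4` restriction of G's floor is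
load-bearing. -/
theorem doorG_without_lowfloor (hHigh : KummerFloor4High) (hCell : KummerFloorCell4) : _root_.ABC :=
  doorG_localised hHigh fun K => abcOn_mono (fun _ _ _ h => h.2) (kummerFloorCell4_iff.mp hCell K)

/-- the carriers are populated: `(1, 2ᴺ − 1, 2ᴺ) ∈ PowAC N` (`N ≥ 1`). -/
theorem powAC_pow_image (N : ℕ) : PowAC N 1 (2 ^ N - 1) (2 ^ N) := ⟨1, 2, (one_pow N).symm, rfl⟩


/-! ### §12b  ATOMS in the critic's blocker grammar v0 (II), shape `Floor_R → (AbcOn (R ∧ P_θ) ↔ AbcOn R)`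
(`R` = the Kummer cell of record, `P` = the power stratum, `Floor_R` = the door's HIGH floor) -/

/-- **door-B atom**: under `KummerFloorHigh` (constant `C₀`), for every `K ≥ C₀`:
`abc|({c ≤ K·N₅⁴} ∩ PowAC 5) ↔ ABC` and `abc|{c ≤ K·N₅⁴} ↔ ABC` — every power-stratum re-cut of B's species is `≡` the species
`≡ S` modulo B's own (HIGH) floor. -/
theorem doorB_atom (hHigh : KummerFloorHigh) :
    ∃ C₀ : ℕ, ∀ K : ℕ, C₀ ≤ K →
      (AbcOn (fun a b c => KCell5 K a b c ∧ PowAC 5 a b c) ↔ _root_.ABC) ∧ (AbcOn (KCell5 K) ↔ _root_.ABC) := by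
  obtain ⟨C₀, hC₀⟩ := hHigh
  refine ⟨C₀, fun K hK => ?_⟩
  have mem : ∀ a b c, IsABCTriple a b c → PowAC 5 a b c → KCell5 K a b c := by
    intro a b c ht hP
    obtain ⟨x, z, hx, hz⟩ := hP
    exact (hC₀ a b c ht (Or.inr (Or.inl ⟨x, z, hx, hz⟩))).trans (Nat.mul_le_mul_right _ hK)
  have key : AbcOn (fun a b c => KCell5 K a b c ∧ PowAC 5 a b c) → _root_.ABC := fun h =>
    (abc_iff_powAC 4).mpr (abcOn_mono' (fun a b c ht hP => ⟨mem a b c ht hP, hP⟩) h)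
  exact ⟨⟨key, fun hS => abcOn_of_abc hS _⟩,
    ⟨fun h => key (abcOn_mono (fun _ _ _ h' => h'.1) h), fun hS => abcOn_of_abc hS _⟩⟩

/-- **door-G atom**: under `KummerFloor4High` (constant `C₀`; implied by G's `KummerFloor4`), for every `K ≥ C₀`:
`abc|({c ≤ K·N₄⁵} ∩ PowAC 4) ↔ ABC` and `abc|{c ≤ K·N₄⁵} ↔ ABC`. -/
theorem doorG_atom (hHigh : KummerFloor4High) :
    ∃ C₀ : ℕ, ∀ K : ℕ, C₀ ≤ K →
      (AbcOn (fun a b c => KCell4 K a b c ∧ PowAC 4 a b c) ↔ _root_.ABC) ∧ (AbcOn (KCell4 K) ↔ _root_.ABC) := by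
  obtain ⟨C₀, hC₀⟩ := hHigh
  refine ⟨C₀, fun K hK => ?_⟩
  have mem : ∀ a b c, IsABCTriple a b c → PowAC 4 a b c → KCell4 K a b c := fun a b c ht hP =>
    (hC₀ a b c ht hP).trans (Nat.mul_le_mul_right _ hK)
  have key : AbcOn (fun a b c => KCell4 K a b c ∧ PowAC 4 a b c) → _root_.ABC := fun h =>
    (abc_iff_powAC 3).mpr (abcOn_mono' (fun a b c ht hP => ⟨mem a b c ht hP, hP⟩) h)
  exact ⟨⟨key, fun hS => abcOn_of_abc hS _⟩,
    ⟨fun h => key (abcOn_mono (fun _ _ _ h' => h'.1) h), fun hS => abcOn_of_abc hS _⟩⟩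

/-- **profile atom** (shape `∀ θ, ABC ↔ AbcOn P_θ`, grammar R-PROFILE), collected: for every `N ≥ 1` and each position pair. -/
theorem profile_atom {N : ℕ} (hN : N ≠ 0) :
    (_root_.ABC ↔ AbcOn (FullAC N)) ∧ (_root_.ABC ↔ AbcOn (FullBC N)) ∧ (_root_.ABC ↔ AbcOn (FullAB N)) ∧
      (_root_.ABC ↔ AbcOn (PowAC N)) := by
  obtain ⟨k, rfl⟩ := Nat.exists_eq_succ_of_ne_zero hN
  exact ⟨abc_iff_fullAC k, abc_iff_fullBC k, abc_iff_fullAB' hN, abc_iff_powAC k⟩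

/-- (III) honesty clause, lens-1's share: the cut-grammars NOT atomised by any loading map in this file. -/
def OpenGrammarsLens1 : List String :=
  ["valuation CEILINGS / residue classes (N₅, N₄: no identity certifies v_p ≢ 0 mod n on its image)",
   "the icosahedral profile cell (2,3,5) — test T_ico (no ℚ-transport of minimal degree 60)",
   "ORDERED / exact-level profile refinements (image position of the deep member not controlled)",
   "all-three-members-N-full (Fermat-type: bounded, = P_H territory, not a loading target)"]

end Summit.ABC.ABC.Theorems.PlatonicClosureCore
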